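import Literature.Analysis.FluidPDE.HolderExtraction
import HarnessLib

/-!
# Diagonal Arzelà–Ascoli extraction for locally bounded families with a common MODULUS of
# continuity, and the packaged slab limit (uniform on pieces ⇒ locally uniform on the open slab)

Analysis/FluidPDE support file (everything proved; no definitions, no named facts).

`HolderExtraction.lean` isolates the general-topology half of Koch–Nadirashvili–Seregin–Šverák's
compactness Lemma 6.1 (arXiv:0709.3599 p. 11; as used on p. 13: "we can choose a subsequence …
such that the `w⁽ᵏ⁾` converge uniformly on compact subsets of `ℝ³ × (−∞, 0)`") for families
sharing a HÖLDER modulus `K n · dist^{α n}` on each compact piece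
(`exists_strictMono_tendstoUniformlyOn_of_bound`). Arzelà–Ascoli needs only equicontinuity, i.e.
ANY common modulus `ω n` with `ω n (d) → 0` as `d → 0`; this file records that form, which is the
one a FORCED Oseen identity delivers (a bounded solution of `u(t) = e^{(t−s)Δ}u(s) − B(u,u)(t) +
∫ₛᵗ e^{(t−τ)Δ} g(τ) dτ` has the Hölder modulus of the unforced theory plus the modulus of the
forcing Duhamel term over short lags, in general not a power):

* `exists_strictMono_tendstoUniformlyOn_of_modulus` — compact sets `T n`, maps `V k` into a proper
  normed group, eventually (in `k`) continuous on `T n`, bounded there by `R n` and with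
  `dist (V k z) (V k z') ≤ ω n (dist z z')`, where `ω n → 0` at `0` and `ω n ≥ 0` on `[0, ∞)`:
  some subsequence converges uniformly on every `T n` to one map `W` (proof = that of the Hölder
  sibling verbatim, with Mathlib's `Metric.equicontinuous_of_continuity_modulus` fed `ω n`);
* `tendstoLocallyUniformlyOn_slab_of_tendstoUniformlyOn_slabPiece` — uniform convergence on every
  slab piece `[−(n+2), −1/(n+2)] × B̄(0, n+2)` gives LOCALLY UNIFORM convergence on the open slab
  `(−∞, 0) × E` in space-time (every point of the slab is interior to a piece,
  `eventually_slabPiece_mem_nhds`) — the space-time clause asked of ladder/zoom limits;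
* `exists_strictMono_slabLimit_of_modulus` — the packaged extraction on the slab pieces of a proper
  space `E`: a subsequence `φ` and a limit `W` continuous on the open slab with `V (φ j) → W`
  uniformly on every piece, locally uniformly on the open slab, pointwise there, and locally
  uniformly on every slice `t < 0` (the output list of the tree's KNSS engine
  `exists_oseenMild_limit_of_monotone_bound`, now for a general modulus).

WHAT THIS IS NOT: no Navier–Stokes content — the moduli `ω n` are hypotheses; which equation
supplies them (unforced Oseen: `exists_holder_quarter_of_oseenMild`; forced: to be proved by the
user) is not this file's business.

## References

* G. Koch, N. Nadirashvili, G. Seregin, V. Šverák, *Liouville theorems for the Navier–Stokes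
  equations and applications*, Acta Math. 203 (2009) 83–105 = arXiv:0709.3599, Lemma 6.1 (p. 11)
  and proof of Thm 6.2 (p. 13). [KochNadirashviliSereginSverak2009]
-/

noncomputable section

open Set Function Filter Topology Metric
open scoped BoundedContinuousFunction NNReal

namespace Literature.Analysis.FluidPDE

/-! ### The diagonal Arzelà–Ascoli extraction with a general modulus -/

section Extraction

/-- **Diagonal Arzelà–Ascoli, locally bounded form, general modulus.** Let `T n` be compact subsets
of a metric space and `V k` maps into a proper normed group which, for each `n` and all large `k`,
are continuous on `T n`, bounded by `R n` there, and share the modulus of continuity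
`dist (V k z) (V k z') ≤ ω n (dist z z')` with `ω n (d) → 0` as `d → 0` and `0 ≤ ω n (d)` for
`0 ≤ d`. Then along some subsequence `φ` the maps `V (φ j)` converge uniformly on every `T n` to a
single map `W` (KNSS 2009, Lemma 6.1: "we can choose a subsequence … converging uniformly on compact
subsets"; Arzelà–Ascoli on each piece and sequential compactness of the product).
[cite: KochNadirashviliSereginSverak2009, Lemma 6.1 (arXiv p. 11) and proof of Thm 6.2 (p. 13)] -/
theorem exists_strictMono_tendstoUniformlyOn_of_modulus {X Y : Type*} [PseudoMetricSpace X]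
    [NormedAddCommGroup Y] [ProperSpace Y] {T : ℕ → Set X} (hT : ∀ n, IsCompact (T n))
    {V : ℕ → X → Y} {R : ℕ → ℝ} {ω : ℕ → ℝ → ℝ} (hω : ∀ n, Tendsto (ω n) (𝓝 0) (𝓝 0))
    (hω0 : ∀ n d, 0 ≤ d → 0 ≤ ω n d)
    (hV : ∀ n, ∀ᶠ k in atTop, ContinuousOn (V k) (T n) ∧ (∀ z ∈ T n, ‖V k z‖ ≤ R n) ∧
      ∀ z ∈ T n, ∀ z' ∈ T n, dist (V k z) (V k z') ≤ ω n (dist z z')) :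
    ∃ φ : ℕ → ℕ, StrictMono φ ∧ ∃ W : X → Y,
      ∀ n, TendstoUniformlyOn (fun j => V (φ j)) W atTop (T n) := by
  classical
  haveI : ∀ n, CompactSpace (T n) := fun n => isCompact_iff_compactSpace.1 (hT n)
  -- the compact sets of bounded continuous functions on the `T n` cut out by the bounds
  let S : ∀ n, Set (T n →ᵇ Y) := fun n =>
    {f | (∀ x, ‖f x‖ ≤ R n) ∧ ∀ x y, dist (f x) (f y) ≤ ω n (dist x y)}
  have hS : ∀ n, IsCompact (S n) := by
    intro n
    refine BoundedContinuousFunction.arzela_ascoli₂ (closedBall (0 : Y) (R n))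
      (isCompact_closedBall 0 (R n)) (S n) ?_ (fun f x hf => mem_closedBall_zero_iff.2 (hf.1 x)) ?_
    · have h1 : IsClosed {f : T n →ᵇ Y | ∀ x, ‖f x‖ ≤ R n} := by
        have heq : {f : T n →ᵇ Y | ∀ x, ‖f x‖ ≤ R n} = ⋂ x, {f | ‖f x‖ ≤ R n} := by
          ext f
          simp
        rw [heq]
        exact isClosed_iInter fun x =>
          isClosed_le (continuous_eval_const x).norm continuous_const
      have h2 : IsClosed {f : T n →ᵇ Y | ∀ x y, dist (f x) (f y) ≤ ω n (dist x y)} := by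
        have heq : {f : T n →ᵇ Y | ∀ x y, dist (f x) (f y) ≤ ω n (dist x y)} =
            ⋂ x, ⋂ y, {f | dist (f x) (f y) ≤ ω n (dist x y)} := by
          ext f
          simp
        rw [heq]
        exact isClosed_iInter fun x => isClosed_iInter fun y =>
          isClosed_le ((continuous_eval_const x).dist
            (continuous_eval_const y)) continuous_const
      exact h1.inter h2
    · refine Metric.equicontinuous_of_continuity_modulus (ω n) (hω n) _ ?_
      rintro x y ⟨f, hf⟩
      exact hf.2 x y
  have hSpi : IsCompact (Set.pi univ S) := isCompact_univ_pi hS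
  -- the bounds, and the restrictions of the `V k` to the `T n` as bounded continuous functions
  let P : ℕ → ℕ → Prop := fun n k => ContinuousOn (V k) (T n) ∧ (∀ z ∈ T n, ‖V k z‖ ≤ R n) ∧
    ∀ z ∈ T n, ∀ z' ∈ T n, dist (V k z) (V k z') ≤ ω n (dist z z')
  let F : ℕ → ∀ n, (T n →ᵇ Y) := fun k n =>
    if h : P n k then BoundedContinuousFunction.mkOfCompact
      ⟨(T n).restrict (V k), continuousOn_iff_continuous_restrict.1 h.1⟩ else
      BoundedContinuousFunction.const (T n) (if hz : (T n).Nonempty then V (Nat.find (hV n).exists)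
        hz.some else 0)
  have hFP : ∀ k n, P n k → ∀ x : T n, F k n x = V k x := fun k n h x => by
    simp only [F, dif_pos h]
    rfl
  have hF : ∀ k, F k ∈ Set.pi univ S := by
    intro k n _
    by_cases h : P n k
    · refine ⟨fun x => ?_, fun x y => ?_⟩
      · rw [hFP k n h x]
        exact h.2.1 x x.2
      · rw [hFP k n h x, hFP k n h y]
        exact h.2.2 x x.2 y y.2
    · -- the fallback constant: a value of an admissible `V k₀` (so that the bound `R n` holds)
      have hk₀ : P n (Nat.find (hV n).exists) := Nat.find_spec (hV n).exists
      simp only [F, dif_neg h]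
      refine ⟨fun x => ?_, fun x y => ?_⟩
      · have hz : (T n).Nonempty := ⟨x, x.2⟩
        simp only [BoundedContinuousFunction.const_apply, dif_pos hz]
        exact hk₀.2.1 _ hz.some_mem
      · simp only [BoundedContinuousFunction.const_apply, dist_self]
        exact hω0 n _ dist_nonneg
  -- one subsequence for all `n` at once: sequential compactness of the product
  obtain ⟨G, -, φ, hφ, hlim⟩ := hSpi.tendsto_subseq hF
  refine ⟨φ, hφ, ?_⟩
  have hn : ∀ n, TendstoUniformly (fun j => ⇑(F (φ j) n)) (⇑(G n)) atTop := fun n =>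
    BoundedContinuousFunction.tendsto_iff_tendstoUniformly.1
      (((continuous_apply n).tendsto G).comp hlim)
  have hev : ∀ n, ∀ᶠ j in atTop, ∀ x : T n, F (φ j) n x = V (φ j) x := fun n => by
    filter_upwards [hφ.tendsto_atTop.eventually (hV n)] with j hj
    exact hFP (φ j) n hj
  have hpt : ∀ m (z : X) (hz : z ∈ T m),
      Tendsto (fun j => V (φ j) z) atTop (𝓝 (G m ⟨z, hz⟩)) := fun m z hz => by
    refine ((hn m).tendsto_at ⟨z, hz⟩).congr' ?_
    filter_upwards [hev m] with j hj
    exact hj ⟨z, hz⟩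
  -- the common limit
  let W : X → Y := fun z => if h : ∃ n, z ∈ T n then G (Nat.find h) ⟨z, Nat.find_spec h⟩ else 0
  refine ⟨W, fun n => ?_⟩
  have hW : ∀ z (hz : z ∈ T n), W z = G n ⟨z, hz⟩ := fun z hz => by
    have hex : ∃ m, z ∈ T m := ⟨n, hz⟩
    simp only [W, dif_pos hex]
    exact tendsto_nhds_unique (hpt _ z _) (hpt n z hz)
  rw [tendstoUniformlyOn_iff_tendstoUniformly_comp_coe]
  have hWG : (W ∘ ((↑) : T n → X)) = ⇑(G n) := funext fun x => by
    simpa using hW x x.2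
  rw [hWG, tendstoUniformly_congr (F' := fun j => ⇑(F (φ j) n))]
  · exact hn n
  · filter_upwards [hev n] with j hj
    exact funext fun x => (hj x).symm

/-- The Hölder modulus `K d^α` (`0 ≤ K`, `0 < α`) is an admissible modulus: it tends to `0` at `0`
and is nonnegative on `[0, ∞)`; so `exists_strictMono_tendstoUniformlyOn_of_bound` is the special
case `ω n d = K n · d ^ α n` of `exists_strictMono_tendstoUniformlyOn_of_modulus`.
[cite: KochNadirashviliSereginSverak2009, Lemma 6.1 (arXiv p. 11)] -/
theorem tendsto_holderModulus_nhds_zero {K α : ℝ} (hα : 0 < α) :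
    Tendsto (fun d : ℝ => K * d ^ α) (𝓝 0) (𝓝 0) := by
  have hc : Continuous fun d : ℝ => K * d ^ α :=
    continuous_const.mul (continuous_id.rpow_const fun d => Or.inr hα.le)
  simpa [Real.zero_rpow hα.ne'] using hc.tendsto 0

/-- A SUM of two admissible moduli is admissible (e.g. the Hölder modulus of the unforced Oseen
theory plus the short-lag modulus of a forcing Duhamel term).
[cite: KochNadirashviliSereginSverak2009, Lemma 6.1 (arXiv p. 11)] -/
theorem tendsto_add_modulus_nhds_zero {ω₁ ω₂ : ℝ → ℝ} (h₁ : Tendsto ω₁ (𝓝 0) (𝓝 0))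
    (h₂ : Tendsto ω₂ (𝓝 0) (𝓝 0)) : Tendsto (fun d => ω₁ d + ω₂ d) (𝓝 0) (𝓝 0) := by
  simpa using h₁.add h₂

end Extraction

/-! ### From uniform convergence on the slab pieces to locally uniform convergence on the slab -/

section Slab

variable {E : Type*} [NormedAddCommGroup E] {Y : Type*} [UniformSpace Y]

/-- **Space-time locally uniform convergence on the open slab** from uniform convergence on the
pieces `[−(n+2), −1/(n+2)] × B̄(0, n+2)`: every point of `(−∞, 0) × E` is interior to some piece
(`eventually_slabPiece_mem_nhds`), so `V j → W` locally uniformly on `(−∞, 0) × E` — "uniformly on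
compact subsets of `ℝ³ × (−∞, 0)`" in KNSS's words.
[cite: KochNadirashviliSereginSverak2009, proof of Thm 6.2 (arXiv p. 13)] -/
theorem tendstoLocallyUniformlyOn_slab_of_tendstoUniformlyOn_slabPiece {ι : Type*} {p : Filter ι}
    {V : ι → ℝ × E → Y} {W : ℝ × E → Y}
    (hW : ∀ n : ℕ, TendstoUniformlyOn V W p
      (Icc (-((n : ℝ) + 2)) (-(1 / ((n : ℝ) + 2))) ×ˢ closedBall (0 : E) ((n : ℝ) + 2))) :
    TendstoLocallyUniformlyOn V W p (Iio 0 ×ˢ univ) := by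
  rintro u hu ⟨t, x⟩ ⟨ht, -⟩
  obtain ⟨n, hn⟩ := (eventually_slabPiece_mem_nhds (E := E) ht x).exists
  exact ⟨_, mem_nhdsWithin_of_mem_nhds hn, hW n u hu⟩

variable [ProperSpace E] {F : Type*} [NormedAddCommGroup F] [ProperSpace F]

/-- **The packaged slab extraction, general modulus.** Let `V k : ℝ × E → F` (`E` proper, `F` a
proper normed group) be, for each slab piece `T n = [−(n+2), −1/(n+2)] × B̄(0, n+2)` and all large
`k`, continuous on `T n`, bounded there by `R n`, with a common modulus `ω n` (`ω n → 0` at `0`,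
`ω n ≥ 0` on `[0, ∞)`). Then along a subsequence `φ` the maps converge — uniformly on every piece,
LOCALLY UNIFORMLY on the open slab `(−∞, 0) × E`, pointwise there, and locally uniformly on every
slice `t < 0` — to a map `W` continuous on the open slab. (KNSS 2009, Lemma 6.1's extraction, with
the equicontinuity supplied as an abstract modulus.)
[cite: KochNadirashviliSereginSverak2009, Lemma 6.1 (arXiv p. 11) and proof of Thm 6.2 (p. 13)] -/
theorem exists_strictMono_slabLimit_of_modulus {V : ℕ → ℝ × E → F} {R : ℕ → ℝ}
    {ω : ℕ → ℝ → ℝ} (hω : ∀ n, Tendsto (ω n) (𝓝 0) (𝓝 0)) (hω0 : ∀ n d, 0 ≤ d → 0 ≤ ω n d)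
    (hV : ∀ n : ℕ, ∀ᶠ k in atTop,
      ContinuousOn (V k) (Icc (-((n : ℝ) + 2)) (-(1 / ((n : ℝ) + 2))) ×ˢ closedBall (0 : E) ((n : ℝ) + 2)) ∧
      (∀ z ∈ Icc (-((n : ℝ) + 2)) (-(1 / ((n : ℝ) + 2))) ×ˢ closedBall (0 : E) ((n : ℝ) + 2),
        ‖V k z‖ ≤ R n) ∧
      ∀ z ∈ Icc (-((n : ℝ) + 2)) (-(1 / ((n : ℝ) + 2))) ×ˢ closedBall (0 : E) ((n : ℝ) + 2),
        ∀ z' ∈ Icc (-((n : ℝ) + 2)) (-(1 / ((n : ℝ) + 2))) ×ˢ closedBall (0 : E) ((n : ℝ) + 2),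
          dist (V k z) (V k z') ≤ ω n (dist z z')) :
    ∃ (φ : ℕ → ℕ) (W : ℝ × E → F), StrictMono φ ∧
      ContinuousOn W (Iio 0 ×ˢ univ) ∧
      (∀ n : ℕ, TendstoUniformlyOn (fun j => V (φ j)) W atTop
        (Icc (-((n : ℝ) + 2)) (-(1 / ((n : ℝ) + 2))) ×ˢ closedBall (0 : E) ((n : ℝ) + 2))) ∧
      TendstoLocallyUniformlyOn (fun j => V (φ j)) W atTop (Iio 0 ×ˢ univ) ∧
      (∀ t < 0, ∀ x, Tendsto (fun j => V (φ j) (t, x)) atTop (𝓝 (W (t, x)))) ∧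
      (∀ t < 0, TendstoLocallyUniformly (fun j x => V (φ j) (t, x)) (fun x => W (t, x)) atTop) := by
  obtain ⟨φ, hφ, W, hWn⟩ := exists_strictMono_tendstoUniformlyOn_of_modulus
    (fun n => isCompact_slabPiece (E := E) n) hω hω0 hV
  have hcont : ∀ n : ℕ, ∀ᶠ j in atTop, ContinuousOn (V (φ j))
      (Icc (-((n : ℝ) + 2)) (-(1 / ((n : ℝ) + 2))) ×ˢ closedBall (0 : E) ((n : ℝ) + 2)) := fun n =>
    (hφ.tendsto_atTop.eventually (hV n)).mono fun j hj => hj.1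
  exact ⟨φ, W, hφ, continuousOn_slab_of_tendstoUniformlyOn hcont hWn, hWn,
    tendstoLocallyUniformlyOn_slab_of_tendstoUniformlyOn_slabPiece hWn,
    fun t ht x => tendsto_of_tendstoUniformlyOn_slabPiece hWn ht x,
    fun t ht => tendstoLocallyUniformly_slice_of_tendstoUniformlyOn_slabPiece hWn ht⟩

end Slab

end Literature.Analysis.FluidPDE

end
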